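import Literature.Probability.Percolation.FKLoopNestingGaussianLimit
import Literature.Probability.Percolation.FKLoopNestingEnergyKernels
import HarnessLib

/-!
# The Dirichlet energy of a neutral test measure is nonnegative (DKLM 2026, Def. 6 / Cor. 10)

Duminil-Copin–Kozlowski–Lammers–Manolescu, arXiv:2603.06268 (2026), Def. 6(ii) and Cor. 10, use
`Σ(φ) = ∬ G_{ℝ²}(x,y) dφ(x) dφ(y)`, `G_{ℝ²}(x,y) = -(1/2π) log|y - x|`, as the variance of the
limiting centred Gaussian `⟨Γ, φ⟩` for generalised test functions `φ` (finite, compactly supported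
signed measures with `φ(ℝ²) = 0`, Def. 5) of finite Dirichlet energy. That `Σ(φ) ≥ 0` — the
logarithmic kernel is positive definite on NEUTRAL measures — is classical potential theory
(Saff–Totik, *Logarithmic Potentials with External Fields* (1997), Lemma I.1.8: `I(μ - ν) ≥ 0` for
compactly supported positive measures of equal mass and finite energy). This file proves it for
the tree's rendering (`Literature.Probability.Percolation.dirichletEnergy`,
`IsGeneralisedTestFunction`, `HasFiniteDirichletEnergy` of `FKLoopNestingGaussianLimit`):

* `dirichletEnergy_nonneg : IsGeneralisedTestFunction φ → HasFiniteDirichletEnergy φ → 0 ≤ dirichletEnergy φ`.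

Proof (heat-kernel route, tools in `FKLoopNestingEnergyKernels`): write `φ = φ⁺ - φ⁻` (Jordan);
finite energy makes `log|x-y|` integrable for each `φ^± ⊗ φ^±` and the absence of atoms makes the
diagonal null, so `dirichletEnergy φ` is the signed sum of four product integrals
(`integral_integral_fullPlaneGreen`). For each, Frullani `-2 log r = ∫₀^∞ (e^{-tr²} - e^{-t}) dt/t`
and Fubini — legitimate because the Frullani integrand has a constant sign, so its `L¹(dt)` norm
is `2|log r| ∈ L¹` (`integral_neg_two_mul_log_eq`) — give
`∬ G = (1/4π) ∫₀^∞ t⁻¹ ∬ (e^{-t|x-y|²} - e^{-t}) dt` (`integral_fullPlaneGreen_eq`). Summing with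
signs, the `e^{-t}` terms cancel by neutrality (`φ⁺(ℂ) = φ⁻(ℂ)`), and what is left is
`(1/4π) ∫₀^∞ t⁻¹ Q_t dt` with `Q_t ≥ 0` the Gaussian form of `φ⁺ - φ⁻` (`gaussian_form_sub_nonneg`).
Compact support is not used. Not here: strict positivity / `Σ(φ) = 0 ↔ φ = 0`.

## References

* H. Duminil-Copin, K. K. Kozlowski, P. Lammers, I. Manolescu, arXiv:2603.06268 (2026): Def. 5,
  Def. 6(ii), (2.3), Cor. 10.
* E. B. Saff, V. Totik, *Logarithmic Potentials with External Fields*, Springer (1997), Lemma I.1.8.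
-/

noncomputable section

open MeasureTheory Set Filter
open scoped Real Topology ENNReal NNReal

namespace Literature.Probability.Percolation

/-! ### The heat-kernel representation of the logarithmic energy of atomless measures -/

/-- Off-diagonal almost everywhere: if `β` has no atoms then `α ⊗ β`-a.e. `x ≠ y`. [folklore] -/
theorem ae_fst_ne_snd (α β : Measure ℂ) [SFinite β] (hβ : ∀ x, β {x} = 0) :
    ∀ᵐ p ∂(α.prod β), p.1 ≠ p.2 := by
  rw [ae_iff]
  have hset : {p : ℂ × ℂ | ¬p.1 ≠ p.2} = Set.diagonal ℂ := by
    ext p; simp [Set.diagonal]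
  rw [hset, Measure.measure_prod_null measurableSet_diagonal]
  refine ae_of_all _ fun x ↦ ?_
  have : Prod.mk x ⁻¹' Set.diagonal ℂ = {x} := by
    ext y; simp [Set.diagonal, eq_comm]
  simp only [this, hβ, Pi.zero_apply]

/-- Measurability of the Frullani integrand `(p, t) ↦ t⁻¹ (e^{-t|x-y|²} - e^{-t})`. [folklore] -/
theorem measurable_frullaniIntegrand :
    Measurable (Function.uncurry fun (p : ℂ × ℂ) (t : ℝ) ↦
      t⁻¹ * (Real.exp (-(t * ‖p.1 - p.2‖ ^ 2)) - Real.exp (-(t * 1)))) := by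
  change Measurable fun q : (ℂ × ℂ) × ℝ ↦
    q.2⁻¹ * (Real.exp (-(q.2 * ‖q.1.1 - q.1.2‖ ^ 2)) - Real.exp (-(q.2 * 1)))
  fun_prop

/-- The `L¹((0,∞), dt)`-norm of the Frullani integrand at `r = |x - y| > 0` is `2 |log r|`: the
integrand has a constant sign. [folklore] -/
theorem integral_norm_frullaniIntegrand {r : ℝ} (hr : 0 < r) :
    ∫ t in Ioi (0 : ℝ), ‖t⁻¹ * (Real.exp (-(t * r ^ 2)) - Real.exp (-(t * 1)))‖ =
      2 * |Real.log r| := by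
  obtain ⟨_, hv⟩ := frullani_log hr
  have hv' : ∫ t in Ioi (0 : ℝ), t⁻¹ * (Real.exp (-(t * r ^ 2)) - Real.exp (-(t * 1))) =
      -2 * Real.log r := by
    rw [← hv]
    refine setIntegral_congr_fun measurableSet_Ioi fun t _ ↦ ?_
    ring
  rcases le_total r 1 with h | h
  · -- `r ≤ 1`: the integrand is nonnegative and `log r ≤ 0`
    have hlog : Real.log r ≤ 0 := Real.log_nonpos hr.le h
    rw [abs_of_nonpos hlog]
    have : ∫ t in Ioi (0 : ℝ), ‖t⁻¹ * (Real.exp (-(t * r ^ 2)) - Real.exp (-(t * 1)))‖ =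
        ∫ t in Ioi (0 : ℝ), t⁻¹ * (Real.exp (-(t * r ^ 2)) - Real.exp (-(t * 1))) := by
      refine setIntegral_congr_fun measurableSet_Ioi fun t ht ↦ ?_
      refine Real.norm_of_nonneg (mul_nonneg (inv_nonneg.2 (le_of_lt ht)) ?_)
      rw [sub_nonneg]
      refine Real.exp_le_exp.2 (neg_le_neg ?_)
      have : r ^ 2 ≤ 1 := pow_le_one₀ hr.le h
      nlinarith [mem_Ioi.1 ht]
    rw [this, hv']
    ring
  · -- `1 ≤ r`: the integrand is nonpositive and `log r ≥ 0`
    have hlog : 0 ≤ Real.log r := Real.log_nonneg h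
    rw [abs_of_nonneg hlog]
    have : ∫ t in Ioi (0 : ℝ), ‖t⁻¹ * (Real.exp (-(t * r ^ 2)) - Real.exp (-(t * 1)))‖ =
        ∫ t in Ioi (0 : ℝ), -(t⁻¹ * (Real.exp (-(t * r ^ 2)) - Real.exp (-(t * 1)))) := by
      refine setIntegral_congr_fun measurableSet_Ioi fun t ht ↦ ?_
      refine Real.norm_of_nonpos (mul_nonpos_of_nonneg_of_nonpos (inv_nonneg.2 (le_of_lt ht)) ?_)
      rw [sub_nonpos]
      refine Real.exp_le_exp.2 (neg_le_neg ?_)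
      have : 1 ≤ r ^ 2 := one_le_pow₀ h
      nlinarith [mem_Ioi.1 ht]
    rw [this, integral_neg, hv']
    ring

/-- **Heat-kernel representation of the mutual logarithmic energy.** For finite measures `α, β` on
the plane, `β` atomless and `log|x - y| ∈ L¹(α ⊗ β)`:
`∬ -2 log|x-y| dα dβ = ∫₀^∞ t⁻¹ ∬ (e^{-t|x-y|²} - e^{-t}) dα dβ dt`, the `t`-integrand being
integrable on `(0, ∞)` (Frullani under the integral sign; Fubini is justified because the
Frullani integrand has a constant sign, so its `L¹(dt)`-norm is `2|log|x-y||`). [folklore] -/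
theorem integral_neg_two_mul_log_eq (α β : Measure ℂ) [IsFiniteMeasure α] [IsFiniteMeasure β]
    (hβ : ∀ x, β {x} = 0)
    (hlog : Integrable (fun p : ℂ × ℂ ↦ Real.log ‖p.1 - p.2‖) (α.prod β)) :
    IntegrableOn (fun t : ℝ ↦ ∫ p, t⁻¹ * (Real.exp (-(t * ‖p.1 - p.2‖ ^ 2)) - Real.exp (-(t * 1)))
        ∂(α.prod β)) (Ioi 0) ∧
      ∫ p, -2 * Real.log ‖p.1 - p.2‖ ∂(α.prod β) =
        ∫ t in Ioi (0 : ℝ), ∫ p, t⁻¹ * (Real.exp (-(t * ‖p.1 - p.2‖ ^ 2)) - Real.exp (-(t * 1)))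
          ∂(α.prod β) := by
  -- pointwise Frullani off the diagonal
  have hfr : ∀ p : ℂ × ℂ, p.1 ≠ p.2 →
      IntegrableOn (fun t : ℝ ↦ t⁻¹ * (Real.exp (-(t * ‖p.1 - p.2‖ ^ 2)) - Real.exp (-(t * 1))))
        (Ioi 0) ∧
      ∫ t in Ioi (0 : ℝ), t⁻¹ * (Real.exp (-(t * ‖p.1 - p.2‖ ^ 2)) - Real.exp (-(t * 1))) =
        -2 * Real.log ‖p.1 - p.2‖ := by
    intro p hp
    have hr : 0 < ‖p.1 - p.2‖ := norm_pos_iff.2 (sub_ne_zero.2 hp)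
    obtain ⟨hi, hv⟩ := frullani_log hr
    have e : (fun t : ℝ ↦ t⁻¹ * (Real.exp (-(t * ‖p.1 - p.2‖ ^ 2)) - Real.exp (-(t * 1)))) =
        fun t ↦ (Real.exp (-(t * ‖p.1 - p.2‖ ^ 2)) - Real.exp (-(t * 1))) / t := by
      funext t; ring
    rw [e]
    exact ⟨hi, hv⟩
  -- joint integrability on `(α ⊗ β) ⊗ dt|_{(0,∞)}`
  have hInt : Integrable (Function.uncurry fun (p : ℂ × ℂ) (t : ℝ) ↦
      t⁻¹ * (Real.exp (-(t * ‖p.1 - p.2‖ ^ 2)) - Real.exp (-(t * 1))))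
      ((α.prod β).prod (volume.restrict (Ioi (0 : ℝ)))) := by
    rw [integrable_prod_iff measurable_frullaniIntegrand.aestronglyMeasurable]
    constructor
    · filter_upwards [ae_fst_ne_snd α β hβ] with p hp
      exact (hfr p hp).1
    · have h2 : Integrable (fun p : ℂ × ℂ ↦ 2 * |Real.log ‖p.1 - p.2‖|) (α.prod β) :=
        hlog.abs.const_mul 2
      refine h2.congr ?_
      filter_upwards [ae_fst_ne_snd α β hβ] with p hp
      have hr : 0 < ‖p.1 - p.2‖ := norm_pos_iff.2 (sub_ne_zero.2 hp)
      simp only [Function.uncurry_apply_pair]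
      exact (integral_norm_frullaniIntegrand hr).symm
  refine ⟨hInt.integral_prod_right, ?_⟩
  rw [← integral_integral_swap hInt]
  refine integral_congr_ae ?_
  filter_upwards [ae_fst_ne_snd α β hβ] with p hp
  exact (hfr p hp).2.symm

/-- The inner integral of the representation: `∬ t⁻¹(e^{-t|x-y|²} - e^{-t}) dα dβ =
t⁻¹ (∬ e^{-t|x-y|²} dα dβ - e^{-t} α(ℂ) β(ℂ))`. [folklore] -/
theorem integral_frullaniIntegrand_eq (α β : Measure ℂ) [IsFiniteMeasure α] [IsFiniteMeasure β]
    (t : ℝ) (ht : 0 ≤ t) :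
    ∫ p, t⁻¹ * (Real.exp (-(t * ‖p.1 - p.2‖ ^ 2)) - Real.exp (-(t * 1))) ∂(α.prod β) =
      t⁻¹ * ((∫ p, Real.exp (-(t * ‖p.1 - p.2‖ ^ 2)) ∂(α.prod β)) -
        Real.exp (-t) * (α.real univ * β.real univ)) := by
  rw [integral_const_mul]
  congr 1
  have hK : Integrable (fun p : ℂ × ℂ ↦ Real.exp (-(t * ‖p.1 - p.2‖ ^ 2))) (α.prod β) := by
    simpa only [neg_mul] using integrable_exp_neg_mul_sq_norm_prod α β ht
  rw [integral_sub hK (integrable_const _), integral_const, smul_eq_mul, mul_one]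
  congr 1
  rw [mul_comm]
  congr 1
  rw [measureReal_def, ← univ_prod_univ, Measure.prod_prod, ENNReal.toReal_mul]
  rfl

/-! ### Positivity of the Dirichlet energy of neutral test measures -/

/-- The total variation of a signed measure is a finite measure. [folklore] -/
theorem isFiniteMeasure_totalVariation (φ : SignedMeasure ℂ) : IsFiniteMeasure φ.totalVariation := by
  rw [SignedMeasure.totalVariation]
  infer_instance

/-- `log|x - y|` is `γ ⊗ γ'`-integrable for any two of `φ⁺, φ⁻` when `φ` has finite Dirichlet
energy. [cite: DuminilCopinKozlowskiLammersManolescu2026, Def. 6(ii)] -/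
theorem HasFiniteDirichletEnergy.integrable_log_of_le {φ : SignedMeasure ℂ}
    (hE : HasFiniteDirichletEnergy φ) {γ γ' : Measure ℂ} [IsFiniteMeasure γ']
    (hγ : γ ≤ φ.totalVariation) (hγ' : γ' ≤ φ.totalVariation) :
    Integrable (fun p : ℂ × ℂ ↦ Real.log ‖p.1 - p.2‖) (γ.prod γ') := by
  haveI := isFiniteMeasure_totalVariation φ
  have h := (hE.integrable_fullPlaneGreen.mono_measure (Measure.prod_mono hγ hγ')).const_mul
    (-(2 * π))
  refine h.congr (ae_of_all _ fun p ↦ ?_)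
  simp only [fullPlaneGreen, norm_sub_rev p.2 p.1]
  field_simp

/-- The Green kernel is `γ ⊗ γ'`-integrable for any two of `φ⁺, φ⁻`.
[cite: DuminilCopinKozlowskiLammersManolescu2026, Def. 6(ii)] -/
theorem HasFiniteDirichletEnergy.integrable_fullPlaneGreen_of_le {φ : SignedMeasure ℂ}
    (hE : HasFiniteDirichletEnergy φ) {γ γ' : Measure ℂ} [IsFiniteMeasure γ']
    (hγ : γ ≤ φ.totalVariation) (hγ' : γ' ≤ φ.totalVariation) :
    Integrable (fun p : ℂ × ℂ ↦ fullPlaneGreen p.1 p.2) (γ.prod γ') := by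
  haveI := isFiniteMeasure_totalVariation φ
  exact hE.integrable_fullPlaneGreen.mono_measure (Measure.prod_mono hγ hγ')

/-- `φ⁺ ≤ |φ|`. [folklore] -/
theorem posPart_le_totalVariation (φ : SignedMeasure ℂ) :
    φ.toJordanDecomposition.posPart ≤ φ.totalVariation := by
  rw [SignedMeasure.totalVariation]
  exact Measure.le_add_right le_rfl

/-- `φ⁻ ≤ |φ|`. [folklore] -/
theorem negPart_le_totalVariation (φ : SignedMeasure ℂ) :
    φ.toJordanDecomposition.negPart ≤ φ.totalVariation := by
  rw [SignedMeasure.totalVariation]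
  exact Measure.le_add_left le_rfl

/-- The iterated Green integral over `γ, γ'` is the product integral.
[cite: DuminilCopinKozlowskiLammersManolescu2026, Def. 6(ii)] -/
theorem integral_integral_fullPlaneGreen {γ γ' : Measure ℂ} [SFinite γ] [SFinite γ']
    (h : Integrable (fun p : ℂ × ℂ ↦ fullPlaneGreen p.1 p.2) (γ.prod γ')) :
    ∫ x, ∫ y, fullPlaneGreen x y ∂γ' ∂γ = ∫ p, fullPlaneGreen p.1 p.2 ∂(γ.prod γ') :=
  (integral_prod _ h).symm

/-- `∬ G d(γ⊗γ') = (1/4π) ∫₀^∞ t⁻¹ ∬ (e^{-t|x-y|²} - e^{-t}) dγ dγ' dt`.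
[cite: DuminilCopinKozlowskiLammersManolescu2026, (2.3)] -/
theorem integral_fullPlaneGreen_eq (γ γ' : Measure ℂ) [IsFiniteMeasure γ] [IsFiniteMeasure γ']
    (hγ' : ∀ x, γ' {x} = 0)
    (hlog : Integrable (fun p : ℂ × ℂ ↦ Real.log ‖p.1 - p.2‖) (γ.prod γ')) :
    ∫ p, fullPlaneGreen p.1 p.2 ∂(γ.prod γ') =
      1 / (4 * π) * ∫ t in Ioi (0 : ℝ), ∫ p, t⁻¹ * (Real.exp (-(t * ‖p.1 - p.2‖ ^ 2)) -
        Real.exp (-(t * 1))) ∂(γ.prod γ') := by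
  rw [← (integral_neg_two_mul_log_eq γ γ' hγ' hlog).2, ← integral_const_mul]
  refine integral_congr_ae (ae_of_all _ fun p ↦ ?_)
  simp only [fullPlaneGreen, norm_sub_rev p.2 p.1]
  field_simp
  ring

/-- **The Dirichlet energy of a neutral test measure is nonnegative**: for a generalised test
function `φ` (`φ(ℝ²) = 0`) of finite Dirichlet energy, `∬ G_{ℝ²} dφ dφ ≥ 0` — the logarithmic
kernel is positive definite on neutral measures (Saff–Totik, *Logarithmic Potentials with
External Fields*, Lemma I.1.8). Proof: `-2 log r = ∫₀^∞ (e^{-tr²} - e^{-t}) dt/t`; after Fubini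
the `e^{-t}` term drops out by neutrality (`φ⁺(ℝ²) = φ⁻(ℝ²)`) and each Gaussian kernel is
positive definite (`gaussian_form_sub_nonneg`). This is what makes `exp(-½σ²Σ(φ))` the
characteristic function of a centred Gaussian in DKLM's Cor. 10. [folklore] -/
theorem dirichletEnergy_nonneg {φ : SignedMeasure ℂ} (hφ : IsGeneralisedTestFunction φ)
    (hE : HasFiniteDirichletEnergy φ) : 0 ≤ dirichletEnergy φ := by
  set α : Measure ℂ := φ.toJordanDecomposition.posPart with hαdef
  set β : Measure ℂ := φ.toJordanDecomposition.negPart with hβdef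
  have hαle : α ≤ φ.totalVariation := posPart_le_totalVariation φ
  have hβle : β ≤ φ.totalVariation := negPart_le_totalVariation φ
  -- no atoms
  have hatom : ∀ x, α {x} = 0 ∧ β {x} = 0 := fun x ↦ by
    have h := hE.totalVariation_singleton x
    rw [SignedMeasure.totalVariation, Measure.add_apply, add_eq_zero] at h
    exact h
  -- neutrality: `φ⁺(ℂ) = φ⁻(ℂ)`
  have hmass : α.real univ = β.real univ := by
    have h := hφ.apply_univ_eq_zero
    rw [← SignedMeasure.toSignedMeasure_toJordanDecomposition φ, JordanDecomposition.toSignedMeasure,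
      Measure.toSignedMeasure_sub_apply MeasurableSet.univ] at h
    exact sub_eq_zero.1 h
  -- integrability of `G` and `log` for the four pairs
  have hG : ∀ γ γ' : Measure ℂ, IsFiniteMeasure γ' → γ ≤ φ.totalVariation → γ' ≤ φ.totalVariation →
      Integrable (fun p : ℂ × ℂ ↦ fullPlaneGreen p.1 p.2) (γ.prod γ') :=
    fun γ γ' _ hγ hγ' ↦ hE.integrable_fullPlaneGreen_of_le hγ hγ'
  have hL : ∀ γ γ' : Measure ℂ, IsFiniteMeasure γ' → γ ≤ φ.totalVariation → γ' ≤ φ.totalVariation →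
      Integrable (fun p : ℂ × ℂ ↦ Real.log ‖p.1 - p.2‖) (γ.prod γ') :=
    fun γ γ' _ hγ hγ' ↦ hE.integrable_log_of_le hγ hγ'
  -- Step 1: the energy as a signed combination of four product integrals
  have hexpand : dirichletEnergy φ =
      (∫ p, fullPlaneGreen p.1 p.2 ∂(α.prod α)) - (∫ p, fullPlaneGreen p.1 p.2 ∂(α.prod β)) -
        ((∫ p, fullPlaneGreen p.1 p.2 ∂(β.prod α)) - ∫ p, fullPlaneGreen p.1 p.2 ∂(β.prod β)) := by
    rw [dirichletEnergy, signedIntegral]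
    simp only [signedIntegral]
    rw [← hαdef, ← hβdef]
    rw [integral_sub (hG α α inferInstance hαle hαle).integral_prod_left
        (hG α β inferInstance hαle hβle).integral_prod_left,
      integral_sub (hG β α inferInstance hβle hαle).integral_prod_left
        (hG β β inferInstance hβle hβle).integral_prod_left,
      integral_integral_fullPlaneGreen (hG α α inferInstance hαle hαle),
      integral_integral_fullPlaneGreen (hG α β inferInstance hαle hβle),
      integral_integral_fullPlaneGreen (hG β α inferInstance hβle hαle),
      integral_integral_fullPlaneGreen (hG β β inferInstance hβle hβle)]
  -- Step 2: heat-kernel representation of each product integral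
  set J : Measure ℂ → Measure ℂ → ℝ → ℝ := fun γ γ' t ↦
    ∫ p, t⁻¹ * (Real.exp (-(t * ‖p.1 - p.2‖ ^ 2)) - Real.exp (-(t * 1))) ∂(γ.prod γ') with hJ
  have hrep : ∀ γ γ' : Measure ℂ, IsFiniteMeasure γ → IsFiniteMeasure γ' → (∀ x, γ' {x} = 0) →
      γ ≤ φ.totalVariation → γ' ≤ φ.totalVariation →
      IntegrableOn (J γ γ') (Ioi 0) ∧
        ∫ p, fullPlaneGreen p.1 p.2 ∂(γ.prod γ') = 1 / (4 * π) * ∫ t in Ioi (0 : ℝ), J γ γ' t := by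
    intro γ γ' _ _ h0 hγ hγ'
    exact ⟨(integral_neg_two_mul_log_eq γ γ' h0 (hL γ γ' inferInstance hγ hγ')).1,
      integral_fullPlaneGreen_eq γ γ' h0 (hL γ γ' inferInstance hγ hγ')⟩
  obtain ⟨hIaa, hEaa⟩ := hrep α α inferInstance inferInstance (fun x ↦ (hatom x).1) hαle hαle
  obtain ⟨hIab, hEab⟩ := hrep α β inferInstance inferInstance (fun x ↦ (hatom x).2) hαle hβle
  obtain ⟨hIba, hEba⟩ := hrep β α inferInstance inferInstance (fun x ↦ (hatom x).1) hβle hαle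
  obtain ⟨hIbb, hEbb⟩ := hrep β β inferInstance inferInstance (fun x ↦ (hatom x).2) hβle hβle
  -- Step 3: combine under one `t`-integral
  have hcomb : dirichletEnergy φ =
      1 / (4 * π) * ∫ t in Ioi (0 : ℝ), (J α α t - J α β t - (J β α t - J β β t)) := by
    have h1 : IntegrableOn (fun t ↦ J α α t - J α β t) (Ioi 0) := hIaa.sub hIab
    have h2 : IntegrableOn (fun t ↦ J β α t - J β β t) (Ioi 0) := hIba.sub hIbb
    rw [hexpand, hEaa, hEab, hEba, hEbb, integral_sub h1 h2, integral_sub hIaa hIab,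
      integral_sub hIba hIbb]
    ring
  rw [hcomb]
  refine mul_nonneg (by positivity) (setIntegral_nonneg measurableSet_Ioi fun t ht ↦ ?_)
  -- Step 4: the integrand is `t⁻¹ · (Gaussian form of φ⁺ - φ⁻) ≥ 0` by neutrality
  have ht : 0 < t := ht
  simp only [hJ]
  rw [integral_frullaniIntegrand_eq α α t ht.le, integral_frullaniIntegrand_eq α β t ht.le,
    integral_frullaniIntegrand_eq β α t ht.le, integral_frullaniIntegrand_eq β β t ht.le, hmass]
  have hQ := gaussian_form_sub_nonneg' α β ht
  have key : t⁻¹ * ((∫ p, Real.exp (-(t * ‖p.1 - p.2‖ ^ 2)) ∂(α.prod α)) -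
        Real.exp (-t) * (β.real univ * β.real univ)) -
      t⁻¹ * ((∫ p, Real.exp (-(t * ‖p.1 - p.2‖ ^ 2)) ∂(α.prod β)) -
        Real.exp (-t) * (β.real univ * β.real univ)) -
      (t⁻¹ * ((∫ p, Real.exp (-(t * ‖p.1 - p.2‖ ^ 2)) ∂(β.prod α)) -
        Real.exp (-t) * (β.real univ * β.real univ)) -
       t⁻¹ * ((∫ p, Real.exp (-(t * ‖p.1 - p.2‖ ^ 2)) ∂(β.prod β)) -
        Real.exp (-t) * (β.real univ * β.real univ))) =
      t⁻¹ * ((∫ p, Real.exp (-(t * ‖p.1 - p.2‖ ^ 2)) ∂(α.prod α)) -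
        (∫ p, Real.exp (-(t * ‖p.1 - p.2‖ ^ 2)) ∂(α.prod β)) -
        (∫ p, Real.exp (-(t * ‖p.1 - p.2‖ ^ 2)) ∂(β.prod α)) +
        ∫ p, Real.exp (-(t * ‖p.1 - p.2‖ ^ 2)) ∂(β.prod β)) := by
    ring
  rw [key]
  exact mul_nonneg (inv_nonneg.2 ht.le) hQ

end Literature.Probability.Percolation

end
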